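import Summits.CriticalPhenomena.PercolationContinuityZ3.Theorems.PercNearOneGluingNoHeavyQuantGluedPairSDEC
import Summits.CriticalPhenomena.PercolationContinuityZ3.Theorems.PercNearOneGluingNoHeavyQuantThreeRootHeavySingleStep
import HarnessLib

/-!
# QUANT lane R8, T-DEC: THE HEAVY-SINGLE WIDTH-3 FOREST OF DEPTH-1 SIBLINGS IS SDEC AT ITS TRUE FLOOR, ORACLE-FREE — arm-1 g52's
# `sdec_threeRootHeavySingle_of_opened` with all six opened-forest inputs discharged by blob tools and the width-2 theorem of `…QuantGluedPairSDEC`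
# (prim-quant-census-2 gen 79)

builds on p205010 (kernel theorem, internal audit signed; external expert review pending)

Support file (`--supports stmt-CriticalPhenomena-4575`), QUANT lane census seat prim-quant-census-2 (gen 79); memo
`run/shared/lean/prim/quant/prim-quant-census-2-g79/GLUEDPAIR-G79.md` §4.  Theorems only, standard axioms, no sorries, no definitions.

THE STEP (arm-1 g52, `…QuantThreeRootHeavySingleStep`): three opened trees `ρᵢ` (SDEC at `yᵢ`, means `Rᵢ`), root gates `0 < q₂ ≤ q₁ < 1`, `0 < q₃ < 1`
with the HEAVY-SINGLE condition `Q = q₁ + q₂ − q₁q₂ ≤ q₃` and the BALANCE condition `ηᵢ = (q₁R₁ + q₂R₂)/(q₃Rᵢ) ≤ 1`; given SDEC of the opened pair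
`ρ₁ ∗ gate_{q₂/q₁}ρ₂`, of `V = gate_{q₁/q₃}ρ₁ ∗ gate_{q₂/q₃}ρ₂ ∗ ρ₃`, `V₁ = gate_{η₁}ρ₁ ∗ ρ₃`, `V₂ = gate_{η₂}ρ₂ ∗ ρ₃` at suitable floors, the three-tree forest
is SDEC at its TRUE floor `min qᵢyᵢ`.  In the lane these inputs were ORACLE calls (`…QuantThreeRootHeavySingleOracle`).
HERE: when the sub-forest laws `ρᵢ` are BLOB-HULL MEMBERS (`InBlobHull yᵢ Rᵢ Mᵢ ρᵢ`, `yᵢMᵢ ≤ Rᵢ` — glued siblings `R^lo[q](R^K[g])`, stars, sure blocks with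
blobs), every input is kernel: the sub-forests by `sdec_of_inBlobHull`; the opened pair and `V₁, V₂` = (a gated blob-hull law, `sdec_gate`) beside a blob-hull
law (`sdec_lconv_inBlobHull`); `V` = a WIDTH-2 forest of gated depth-1 trees (`sdec_two_of_subBlobHull`, this seat) beside a blob-hull law.  All opened floors
are `x/q₁` resp. `x/q₃`, and every floor side condition reduces to the true floor `x ≤ min qᵢyᵢ` (`q₃ηᵢyᵢ ≥ qᵢyᵢ`).
* `gatedTwo_laws` — law facts of `gate ρ₁ c₁ ∗ gate ρ₂ c₂` for blob-hull `ρᵢ`.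
* **`sdec_three_heavySingle_of_subBlobHull`** — the theorem; **`sdec_flaw_three_heavySingle`** — on the `Sib` binder (hypotheses: `0 < yᵢ < 1`, hull memberships, `yᵢMᵢ ≤ Rᵢ`, `0 < Rᵢ`, gates, `Q ≤ q₃`, balance
  `q₁R₁ + q₂R₂ ≤ q₃R₁`, `q₁R₁ + q₂R₂ ≤ q₃R₂`, floor `0 < x ≤ min qᵢyᵢ`); conclusion
  `SDEC x (M₁+M₂+M₃) ((gate ρ₁ q₁ ∗ gate ρ₂ q₂) ∗ gate ρ₃ q₃)`.

HONEST STATUS.  One orientation (heavy single, balanced) of the width-3 core, oracle-free for depth-1 siblings; the generic orientation (`q₃ ≤ Q`,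
arm-1 g46) carries a floor slack and is not restated; `SiblingStep`, `FarTreeRow` OPEN; RATE class (log\*) / honest sentence of
`run/shared/lean/prim/quant/README.md` unchanged.  [this work]; the step is prim-quant-arm-1 g52's.  Nothing here is cited as a published result.  The gluing
rows served [cite: KozmaNitzan2024, Conjecture 3 (p. 15)]; product measure [cite: Grimmett1999, §1.3 p. 10].
-/

noncomputable section

open scoped BigOperators

namespace Summit.CriticalPhenomena.PercolationContinuityZ3.Theorems
namespace Quant
namespace LawDec

open Finset

/-- law facts of a width-2 forest of gated blob-hull laws `gate ρ₁ c₁ ∗ gate ρ₂ c₂` (`0 ≤ cᵢ ≤ 1`): nonnegative, vanishing above `M₁ + M₂`, mass `1`,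
mean `c₁R₁ + c₂R₂`. [this work] -/
theorem gatedTwo_laws {y₁ y₂ R₁ R₂ c₁ c₂ : ℝ} {M₁ M₂ : ℕ} {ρ₁ ρ₂ : ℕ → ℝ} (hy₁0 : 0 ≤ y₁) (hy₂0 : 0 ≤ y₂)
    (hρ₁ : InBlobHull y₁ R₁ M₁ ρ₁) (hρ₂ : InBlobHull y₂ R₂ M₂ ρ₂) (hc₁0 : 0 ≤ c₁) (hc₁1 : c₁ ≤ 1) (hc₂0 : 0 ≤ c₂) (hc₂1 : c₂ ≤ 1) :
    (∀ h, 0 ≤ lconv M₁ M₂ (gate ρ₁ c₁) (gate ρ₂ c₂) h) ∧ (∀ h, M₁ + M₂ < h → lconv M₁ M₂ (gate ρ₁ c₁) (gate ρ₂ c₂) h = 0) ∧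
      ∑ h ∈ Finset.range (M₁ + M₂ + 1), lconv M₁ M₂ (gate ρ₁ c₁) (gate ρ₂ c₂) h = 1 ∧
      ∑ h ∈ Finset.range (M₁ + M₂ + 1), (h : ℝ) * lconv M₁ M₂ (gate ρ₁ c₁) (gate ρ₂ c₂) h = c₁ * R₁ + c₂ * R₂ := by
  obtain ⟨a0, aM, a1⟩ := hρ₁.lawFacts hy₁0
  obtain ⟨b0, bM, b1⟩ := hρ₂.lawFacts hy₂0
  obtain ⟨u0, uM, u1⟩ := gate_laws M₁ ρ₁ c₁ hc₁0 hc₁1 a0 aM a1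
  obtain ⟨v0, vM, v1⟩ := gate_laws M₂ ρ₂ c₂ hc₂0 hc₂1 b0 bM b1
  refine ⟨lconv_nonneg _ _ _ _ u0 v0, fun h hh => lconv_eq_zero _ _ _ _ h hh, sum_lconv _ _ _ _ u1 v1, ?_⟩
  rw [sum_mul_lconv _ _ _ _ u1 v1, sum_mul_gate, sum_mul_gate, hρ₁.mean_eq, hρ₂.mean_eq]

/-- a gated blob-hull law beside a blob-hull law is SDEC: `0 < w < 1`, `w ≤ c·y₁` (`0 < c ≤ 1`), `w ≤ y₂`, `y₁M₁ ≤ R₁` ⟹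
`SDEC w (M₁ + M₂) (gate ρ₁ c ∗ ρ₂)`. [this work] -/
theorem sdec_gate_lconv_of_subBlobHull {y₁ y₂ R₁ R₂ c w : ℝ} {M₁ M₂ : ℕ} {ρ₁ ρ₂ : ℕ → ℝ} (hy₁0 : 0 < y₁) (hy₁1 : y₁ < 1) (hy₂0 : 0 < y₂)
    (hρ₁ : InBlobHull y₁ R₁ M₁ ρ₁) (hρ₂ : InBlobHull y₂ R₂ M₂ ρ₂) (hta₁ : y₁ * (M₁ : ℝ) ≤ R₁) (hc0 : 0 < c) (hc1 : c ≤ 1)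
    (hw0 : 0 < w) (hw1 : w < 1) (hwc : w ≤ c * y₁) (hwy₂ : w ≤ y₂) :
    SDEC w (M₁ + M₂) (lconv M₁ M₂ (gate ρ₁ c) ρ₂) := by
  obtain ⟨a0, aM, a1⟩ := hρ₁.lawFacts hy₁0.le
  have hS₁ : SDEC y₁ M₁ ρ₁ := sdec_of_inBlobHull hy₁0 hy₁1 hρ₁
  have hS₁' : SDEC (w / c) M₁ ρ₁ := sdec_mono hS₁ (by rw [div_le_iff₀ hc0]; linarith) hy₁1
  have ht : SDEC w M₁ (gate ρ₁ c) := by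
    have := sdec_gate hS₁' c hc0 hc1
    rwa [mul_div_cancel₀ _ hc0.ne'] at this
  obtain ⟨u0, uM, u1⟩ := gate_laws M₁ ρ₁ c hc0.le hc1 a0 aM a1
  have hta : w * (M₁ : ℝ) ≤ ∑ h ∈ Finset.range (M₁ + 1), (h : ℝ) * gate ρ₁ c h := by
    rw [sum_mul_gate, hρ₁.mean_eq]
    have h1 : w * (M₁ : ℝ) ≤ c * y₁ * M₁ := mul_le_mul_of_nonneg_right hwc (Nat.cast_nonneg M₁)
    have h2 : c * (y₁ * (M₁ : ℝ)) ≤ c * R₁ := mul_le_mul_of_nonneg_left hta₁ hc0.le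
    have e1 : c * y₁ * (M₁ : ℝ) = c * (y₁ * (M₁ : ℝ)) := by ring
    linarith
  have _ := hy₂0
  exact sdec_lconv_inBlobHull hw0 hw1 u0 uM u1 hta ht (hρ₂.mono hwy₂ le_rfl)

/-- **THE HEAVY-SINGLE WIDTH-3 FOREST OF DEPTH-1 SIBLINGS IS SDEC AT ITS TRUE FLOOR — NO ORACLE.**  Sub-forest laws `ρᵢ ∈ K_{yᵢ}(Rᵢ)` on `{0..Mᵢ}`
(`InBlobHull`, `0 < yᵢ < 1`, `yᵢMᵢ ≤ Rᵢ`, `0 < R₁, R₂`), root gates `0 < q₂ ≤ q₁ < 1`, `0 < q₃ < 1`, heavy single `q₁ + q₂ − q₁q₂ ≤ q₃`, balance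
`q₁R₁ + q₂R₂ ≤ q₃R₁` and `≤ q₃R₂`, floor `0 < x ≤ min(q₁y₁, q₂y₂, q₃y₃)`:
`SDEC x (M₁+M₂+M₃) ((gate ρ₁ q₁ ∗ gate ρ₂ q₂) ∗ gate ρ₃ q₃)`. [this work] -/
theorem sdec_three_heavySingle_of_subBlobHull {y₁ y₂ y₃ R₁ R₂ R₃ q₁ q₂ q₃ x : ℝ} {M₁ M₂ M₃ : ℕ} {ρ₁ ρ₂ ρ₃ : ℕ → ℝ}
    (hy₁0 : 0 < y₁) (hy₁1 : y₁ < 1) (hy₂0 : 0 < y₂) (hy₂1 : y₂ < 1) (hy₃0 : 0 < y₃) (hy₃1 : y₃ < 1)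
    (hρ₁ : InBlobHull y₁ R₁ M₁ ρ₁) (hρ₂ : InBlobHull y₂ R₂ M₂ ρ₂) (hρ₃ : InBlobHull y₃ R₃ M₃ ρ₃)
    (hta₁ : y₁ * (M₁ : ℝ) ≤ R₁) (hta₂ : y₂ * (M₂ : ℝ) ≤ R₂) (hta₃ : y₃ * (M₃ : ℝ) ≤ R₃) (hR₁0 : 0 < R₁) (hR₂0 : 0 < R₂)
    (hq₂0 : 0 < q₂) (hq₂₁ : q₂ ≤ q₁) (hq₁1 : q₁ < 1) (hq₃0 : 0 < q₃) (hq₃1 : q₃ < 1) (hQq₃ : q₁ + q₂ - q₁ * q₂ ≤ q₃)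
    (hbal₁ : q₁ * R₁ + q₂ * R₂ ≤ q₃ * R₁) (hbal₂ : q₁ * R₁ + q₂ * R₂ ≤ q₃ * R₂)
    (hx0 : 0 < x) (hx₁ : x ≤ q₁ * y₁) (hx₂ : x ≤ q₂ * y₂) (hx₃ : x ≤ q₃ * y₃) :
    SDEC x (M₁ + M₂ + M₃) (lconv (M₁ + M₂) M₃ (lconv M₁ M₂ (gate ρ₁ q₁) (gate ρ₂ q₂)) (gate ρ₃ q₃)) := by
  have hq₁0 : 0 < q₁ := lt_of_lt_of_le hq₂0 hq₂₁
  have hq₁q₃ : q₁ < q₃ := by nlinarith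
  have hq₂q₃ : q₂ < q₃ := lt_of_le_of_lt hq₂₁ hq₁q₃
  obtain ⟨a0, aM, a1⟩ := hρ₁.lawFacts hy₁0.le
  obtain ⟨b0, bM, b1⟩ := hρ₂.lawFacts hy₂0.le
  obtain ⟨c0, cM, c1⟩ := hρ₃.lawFacts hy₃0.le
  have hS₁ : SDEC y₁ M₁ ρ₁ := sdec_of_inBlobHull hy₁0 hy₁1 hρ₁
  have hS₂ : SDEC y₂ M₂ ρ₂ := sdec_of_inBlobHull hy₂0 hy₂1 hρ₂
  have hS₃ : SDEC y₃ M₃ ρ₃ := sdec_of_inBlobHull hy₃0 hy₃1 hρ₃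
  -- the raised gates
  set η₁ : ℝ := (q₁ * R₁ + q₂ * R₂) / (q₃ * R₁) with hη₁
  set η₂ : ℝ := (q₁ * R₁ + q₂ * R₂) / (q₃ * R₂) with hη₂
  have hq₃R₁ : 0 < q₃ * R₁ := mul_pos hq₃0 hR₁0
  have hq₃R₂ : 0 < q₃ * R₂ := mul_pos hq₃0 hR₂0
  have hnum0 : 0 < q₁ * R₁ + q₂ * R₂ := by nlinarith [mul_pos hq₁0 hR₁0, mul_pos hq₂0 hR₂0]
  have hη₁0 : 0 < η₁ := div_pos hnum0 hq₃R₁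
  have hη₂0 : 0 < η₂ := div_pos hnum0 hq₃R₂
  have hη₁1 : η₁ ≤ 1 := (div_le_one hq₃R₁).2 hbal₁
  have hη₂1 : η₂ ≤ 1 := (div_le_one hq₃R₂).2 hbal₂
  have hq₁η₁ : q₁ ≤ q₃ * η₁ := by
    have e : q₃ * η₁ = (q₁ * R₁ + q₂ * R₂) / R₁ := by
      rw [hη₁]; field_simp
    rw [e, le_div_iff₀ hR₁0]; nlinarith [mul_pos hq₂0 hR₂0]
  have hq₂η₂ : q₂ ≤ q₃ * η₂ := by
    have e : q₃ * η₂ = (q₁ * R₁ + q₂ * R₂) / R₂ := by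
      rw [hη₂]; field_simp
    rw [e, le_div_iff₀ hR₂0]; nlinarith [mul_pos hq₁0 hR₁0]
  -- the opened floors
  set w : ℝ := x / q₁ with hw
  set v : ℝ := x / q₃ with hv
  have hw0 : 0 < w := div_pos hx0 hq₁0
  have hv0 : 0 < v := div_pos hx0 hq₃0
  have hwy₁ : w ≤ y₁ := by rw [hw, div_le_iff₀ hq₁0]; linarith
  have hw1 : w < 1 := lt_of_le_of_lt hwy₁ hy₁1
  have hvy₃ : v ≤ y₃ := by rw [hv, div_le_iff₀ hq₃0]; linarith
  have hv1 : v < 1 := lt_of_le_of_lt hvy₃ hy₃1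
  have hxw : x ≤ q₁ * w := by rw [hw, mul_div_cancel₀ _ hq₁0.ne']
  have hxv : x ≤ q₃ * v := by rw [hv, mul_div_cancel₀ _ hq₃0.ne']
  -- (1) the opened pair ρ₁ ∗ gate_{q₂/q₁} ρ₂ at w (second sibling gated, first plain: commute)
  have hG₁₂ : SDEC w (M₁ + M₂) (lconv M₁ M₂ ρ₁ (gate ρ₂ (q₂ / q₁))) := by
    have hc0 : 0 < q₂ / q₁ := div_pos hq₂0 hq₁0
    have hc1 : q₂ / q₁ ≤ 1 := (div_le_one hq₁0).2 hq₂₁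
    have hwc : w ≤ q₂ / q₁ * y₂ := by
      rw [hw, div_mul_eq_mul_div, div_le_div_iff_of_pos_right hq₁0]; exact hx₂
    have := sdec_gate_lconv_of_subBlobHull hy₂0 hy₂1 hy₁0 hρ₂ hρ₁ hta₂ hc0 hc1 hw0 hw1 hwc hwy₁
    rwa [lconv_comm, Nat.add_comm M₂ M₁] at this
  have htaG₁₂ : w * ((M₁ + M₂ : ℕ) : ℝ) ≤ R₁ + q₂ / q₁ * R₂ := by
    have h1 : w * (M₁ : ℝ) ≤ y₁ * M₁ := mul_le_mul_of_nonneg_right hwy₁ (Nat.cast_nonneg M₁)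
    have hwc : w ≤ q₂ / q₁ * y₂ := by
      rw [hw, div_mul_eq_mul_div, div_le_div_iff_of_pos_right hq₁0]; exact hx₂
    have h2 : w * (M₂ : ℝ) ≤ q₂ / q₁ * y₂ * M₂ := mul_le_mul_of_nonneg_right hwc (Nat.cast_nonneg M₂)
    have h3 : q₂ / q₁ * (y₂ * (M₂ : ℝ)) ≤ q₂ / q₁ * R₂ := mul_le_mul_of_nonneg_left hta₂ (div_pos hq₂0 hq₁0).le
    have e : w * ((M₁ + M₂ : ℕ) : ℝ) = w * (M₁ : ℝ) + w * (M₂ : ℝ) := by push_cast; ring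
    have e2 : q₂ / q₁ * y₂ * (M₂ : ℝ) = q₂ / q₁ * (y₂ * (M₂ : ℝ)) := by ring
    rw [e]; linarith
  -- (2) V = (gate_{q₁/q₃}ρ₁ ∗ gate_{q₂/q₃}ρ₂) ∗ ρ₃ at v: the width-2 theorem beside a blob-hull law
  have hc₁0 : 0 < q₁ / q₃ := div_pos hq₁0 hq₃0
  have hc₁1 : q₁ / q₃ < 1 := (div_lt_one hq₃0).2 hq₁q₃
  have hc₂0 : 0 < q₂ / q₃ := div_pos hq₂0 hq₃0
  have hc₂1 : q₂ / q₃ < 1 := (div_lt_one hq₃0).2 hq₂q₃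
  have hv₁ : v ≤ q₁ / q₃ * y₁ := by rw [hv, div_mul_eq_mul_div, div_le_div_iff_of_pos_right hq₃0]; exact hx₁
  have hv₂ : v ≤ q₂ / q₃ * y₂ := by rw [hv, div_mul_eq_mul_div, div_le_div_iff_of_pos_right hq₃0]; exact hx₂
  have hF : SDEC v (M₁ + M₂) (lconv M₁ M₂ (gate ρ₁ (q₁ / q₃)) (gate ρ₂ (q₂ / q₃))) :=
    sdec_two_of_subBlobHull hy₁0 hy₁1 hy₂0 hy₂1 hc₁0 hc₁1 hc₂0 hc₂1 hρ₁ hρ₂ hta₁ hta₂ hv0 hv₁ hv₂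
  obtain ⟨f0, fM, f1, fmn⟩ := gatedTwo_laws hy₁0.le hy₂0.le hρ₁ hρ₂ hc₁0.le hc₁1.le hc₂0.le hc₂1.le
  have htaF0 : v * ((M₁ + M₂ : ℕ) : ℝ) ≤ q₁ / q₃ * R₁ + q₂ / q₃ * R₂ := by
    have h1 : v * (M₁ : ℝ) ≤ q₁ / q₃ * y₁ * M₁ := mul_le_mul_of_nonneg_right hv₁ (Nat.cast_nonneg M₁)
    have h2 : v * (M₂ : ℝ) ≤ q₂ / q₃ * y₂ * M₂ := mul_le_mul_of_nonneg_right hv₂ (Nat.cast_nonneg M₂)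
    have h3 : q₁ / q₃ * (y₁ * (M₁ : ℝ)) ≤ q₁ / q₃ * R₁ := mul_le_mul_of_nonneg_left hta₁ hc₁0.le
    have h4 : q₂ / q₃ * (y₂ * (M₂ : ℝ)) ≤ q₂ / q₃ * R₂ := mul_le_mul_of_nonneg_left hta₂ hc₂0.le
    have e : v * ((M₁ + M₂ : ℕ) : ℝ) = v * (M₁ : ℝ) + v * (M₂ : ℝ) := by push_cast; ring
    have e3 : q₁ / q₃ * y₁ * (M₁ : ℝ) = q₁ / q₃ * (y₁ * (M₁ : ℝ)) := by ring
    have e4 : q₂ / q₃ * y₂ * (M₂ : ℝ) = q₂ / q₃ * (y₂ * (M₂ : ℝ)) := by ring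
    rw [e]; linarith
  have htaF : v * ((M₁ + M₂ : ℕ) : ℝ) ≤ ∑ h ∈ Finset.range (M₁ + M₂ + 1), (h : ℝ) * lconv M₁ M₂ (gate ρ₁ (q₁ / q₃)) (gate ρ₂ (q₂ / q₃)) h := by
    rw [fmn]; exact htaF0
  have hV : SDEC v (M₁ + M₂ + M₃) (lconv (M₁ + M₂) M₃ (lconv M₁ M₂ (gate ρ₁ (q₁ / q₃)) (gate ρ₂ (q₂ / q₃))) ρ₃) :=
    sdec_lconv_inBlobHull hv0 hv1 f0 fM f1 htaF hF (hρ₃.mono hvy₃ le_rfl)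
  have htaV : v * ((M₁ + M₂ + M₃ : ℕ) : ℝ) ≤ q₁ / q₃ * R₁ + q₂ / q₃ * R₂ + R₃ := by
    have h5 : v * (M₃ : ℝ) ≤ y₃ * M₃ := mul_le_mul_of_nonneg_right hvy₃ (Nat.cast_nonneg M₃)
    have e : v * ((M₁ + M₂ + M₃ : ℕ) : ℝ) = v * ((M₁ + M₂ : ℕ) : ℝ) + v * (M₃ : ℝ) := by push_cast; ring
    rw [e]; linarith
  -- (3) V₁ = gate_{η₁}ρ₁ ∗ ρ₃ and V₂ = gate_{η₂}ρ₂ ∗ ρ₃ at v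
  have hvη₁ : v ≤ η₁ * y₁ := by
    have : x ≤ q₃ * η₁ * y₁ := le_trans hx₁ (mul_le_mul_of_nonneg_right hq₁η₁ hy₁0.le)
    rw [hv, div_le_iff₀ hq₃0]; linarith
  have hvη₂ : v ≤ η₂ * y₂ := by
    have : x ≤ q₃ * η₂ * y₂ := le_trans hx₂ (mul_le_mul_of_nonneg_right hq₂η₂ hy₂0.le)
    rw [hv, div_le_iff₀ hq₃0]; linarith
  have hV₁ : SDEC v (M₁ + M₃) (lconv M₁ M₃ (gate ρ₁ η₁) ρ₃) :=
    sdec_gate_lconv_of_subBlobHull hy₁0 hy₁1 hy₃0 hρ₁ hρ₃ hta₁ hη₁0 hη₁1 hv0 hv1 hvη₁ hvy₃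
  have hV₂ : SDEC v (M₂ + M₃) (lconv M₂ M₃ (gate ρ₂ η₂) ρ₃) :=
    sdec_gate_lconv_of_subBlobHull hy₂0 hy₂1 hy₃0 hρ₂ hρ₃ hta₂ hη₂0 hη₂1 hv0 hv1 hvη₂ hvy₃
  have htaV₁ : v * ((M₁ + M₃ : ℕ) : ℝ) ≤ η₁ * R₁ + R₃ := by
    have h1 : v * (M₁ : ℝ) ≤ η₁ * y₁ * M₁ := mul_le_mul_of_nonneg_right hvη₁ (Nat.cast_nonneg M₁)
    have h2 : η₁ * (y₁ * (M₁ : ℝ)) ≤ η₁ * R₁ := mul_le_mul_of_nonneg_left hta₁ hη₁0.le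
    have h3 : v * (M₃ : ℝ) ≤ y₃ * M₃ := mul_le_mul_of_nonneg_right hvy₃ (Nat.cast_nonneg M₃)
    have e : v * ((M₁ + M₃ : ℕ) : ℝ) = v * (M₁ : ℝ) + v * (M₃ : ℝ) := by push_cast; ring
    have e1 : η₁ * y₁ * (M₁ : ℝ) = η₁ * (y₁ * (M₁ : ℝ)) := by ring
    rw [e]; linarith
  have htaV₂ : v * ((M₂ + M₃ : ℕ) : ℝ) ≤ η₂ * R₂ + R₃ := by
    have h1 : v * (M₂ : ℝ) ≤ η₂ * y₂ * M₂ := mul_le_mul_of_nonneg_right hvη₂ (Nat.cast_nonneg M₂)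
    have h2 : η₂ * (y₂ * (M₂ : ℝ)) ≤ η₂ * R₂ := mul_le_mul_of_nonneg_left hta₂ hη₂0.le
    have h3 : v * (M₃ : ℝ) ≤ y₃ * M₃ := mul_le_mul_of_nonneg_right hvy₃ (Nat.cast_nonneg M₃)
    have e : v * ((M₂ + M₃ : ℕ) : ℝ) = v * (M₂ : ℝ) + v * (M₃ : ℝ) := by push_cast; ring
    have e1 : η₂ * y₂ * (M₂ : ℝ) = η₂ * (y₂ * (M₂ : ℝ)) := by ring
    rw [e]; linarith
  exact sdec_threeRootHeavySingle_of_opened y₁ y₂ y₃ w v v v x q₁ q₂ q₃ (q₁ + q₂ - q₁ * q₂) R₁ R₂ R₃ η₁ η₂ M₁ M₂ M₃ ρ₁ ρ₂ ρ₃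
    hy₁0 hy₁1 hy₂0 hy₂1 hy₃0 hy₃1 hw0.le hw1 hv0.le hv1 hv0.le hv1 hv0.le hv1 hq₂0 hq₂₁ hq₁1 hq₃0 hq₃1 rfl hQq₃ hx0
    a0 aM a1 hρ₁.mean_eq hta₁ hR₁0 b0 bM b1 hρ₂.mean_eq hta₂ hR₂0 c0 cM c1 hρ₃.mean_eq hta₃ hS₁ hS₂ hS₃ hη₁ hη₂ hη₁1 hη₂1
    hG₁₂ htaG₁₂ hV htaV hV₁ htaV₁ hV₂ htaV₂ hx₁ hx₂ hx₃ hxw hxv hxv hxv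


/-- **ON THE NODE'S BINDER**: three sibling records `s₁, s₂, s₃` with sub-forest laws in the blob hull (`InBlobHull yᵢ Rᵢ sᵢ.M sᵢ.ρ`, `yᵢ·Mᵢ ≤ Rᵢ`, `0 < R₁, R₂`),
root gates `s₂.q ≤ s₁.q`, heavy single `s₁.q + s₂.q − s₁.q·s₂.q ≤ s₃.q`, balance `s₁.q R₁ + s₂.q R₂ ≤ s₃.q·min(R₁, R₂)`, floor `0 < x ≤ min sᵢ.q·yᵢ`:
`SDEC x (ftop [s₃, s₂, s₁]) (flaw [s₃, s₂, s₁])` (any other order by `sdec_flaw_perm`). [this work] -/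
theorem sdec_flaw_three_heavySingle {x : ℝ} (hx0 : 0 < x) (s₁ s₂ s₃ : Sib) {y₁ y₂ y₃ R₁ R₂ R₃ : ℝ}
    (hy₁0 : 0 < y₁) (hy₁1 : y₁ < 1) (hy₂0 : 0 < y₂) (hy₂1 : y₂ < 1) (hy₃0 : 0 < y₃) (hy₃1 : y₃ < 1)
    (hρ₁ : InBlobHull y₁ R₁ s₁.M s₁.ρ) (hρ₂ : InBlobHull y₂ R₂ s₂.M s₂.ρ) (hρ₃ : InBlobHull y₃ R₃ s₃.M s₃.ρ)
    (hta₁ : y₁ * (s₁.M : ℝ) ≤ R₁) (hta₂ : y₂ * (s₂.M : ℝ) ≤ R₂) (hta₃ : y₃ * (s₃.M : ℝ) ≤ R₃) (hR₁0 : 0 < R₁) (hR₂0 : 0 < R₂)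
    (hq₂0 : 0 < s₂.q) (hq₂₁ : s₂.q ≤ s₁.q) (hq₁1 : s₁.q < 1) (hq₃0 : 0 < s₃.q) (hq₃1 : s₃.q < 1)
    (hQq₃ : s₁.q + s₂.q - s₁.q * s₂.q ≤ s₃.q) (hbal₁ : s₁.q * R₁ + s₂.q * R₂ ≤ s₃.q * R₁) (hbal₂ : s₁.q * R₁ + s₂.q * R₂ ≤ s₃.q * R₂)
    (hx₁ : x ≤ s₁.q * y₁) (hx₂ : x ≤ s₂.q * y₂) (hx₃ : x ≤ s₃.q * y₃) :
    SDEC x (ftop [s₃, s₂, s₁]) (flaw [s₃, s₂, s₁]) := by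
  obtain ⟨_, ρM, _⟩ := hρ₁.lawFacts hy₁0.le
  have e₁ : flaw [s₁] = gate s₁.ρ s₁.q := by
    funext h
    show lconv 0 s₁.M (fun i => if i = 0 then (1 : ℝ) else 0) (gate s₁.ρ s₁.q) h = gate s₁.ρ s₁.q h
    refine lconv_delta_left 0 s₁.M _ (fun k hk => ?_) h
    rw [gate_apply, ρM k hk, if_neg (by omega)]
    ring
  have e₂ : flaw [s₂, s₁] = lconv s₁.M s₂.M (gate s₁.ρ s₁.q) (gate s₂.ρ s₂.q) := by
    show lconv (ftop [s₁]) s₂.M (flaw [s₁]) (gate s₂.ρ s₂.q) = _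
    rw [e₁]
    simp [ftop]
  have e₃ : flaw [s₃, s₂, s₁] = lconv (s₁.M + s₂.M) s₃.M (lconv s₁.M s₂.M (gate s₁.ρ s₁.q) (gate s₂.ρ s₂.q)) (gate s₃.ρ s₃.q) := by
    show lconv (ftop [s₂, s₁]) s₃.M (flaw [s₂, s₁]) (gate s₃.ρ s₃.q) = _
    rw [e₂]
    simp [ftop]
  have eT : ftop [s₃, s₂, s₁] = s₁.M + s₂.M + s₃.M := by simp [ftop]
  rw [e₃, eT]
  exact sdec_three_heavySingle_of_subBlobHull hy₁0 hy₁1 hy₂0 hy₂1 hy₃0 hy₃1 hρ₁ hρ₂ hρ₃ hta₁ hta₂ hta₃ hR₁0 hR₂0 hq₂0 hq₂₁ hq₁1 hq₃0 hq₃1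
    hQq₃ hbal₁ hbal₂ hx0 hx₁ hx₂ hx₃

end LawDec
end Quant
end Summit.CriticalPhenomena.PercolationContinuityZ3.Theorems
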